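import Mathlib
import Summits.ValiantsHypothesis.ValiantsHypothesis.Theses.GrenetZeon
import Summits.ValiantsHypothesis.ValiantsHypothesis.Theorems.GrenetZeonTwoDimCoefficientsDefs
import Summits.ValiantsHypothesis.ValiantsHypothesis.Theorems.GrenetZeonTwoDimCoefficientsDualUnipotentBaseNormalForm
import Summits.ValiantsHypothesis.ValiantsHypothesis.Theorems.GrenetZeonTwoDimCoefficientsDualUnipotentNormalForm
import Summits.ValiantsHypothesis.ValiantsHypothesis.Theorems.GrenetZeonTwoDimCoefficientsDualUnipotentUnfoldCore
import Summits.ValiantsHypothesis.ValiantsHypothesis.Theorems.GrenetZeonTwoDimCoefficientsDualUnipotentLevelFlat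

/-!
# Line `thin_wild` — THIN WILD CONSTITUENTS (val-idea-9 g2, negation lens, crux `GrenetZeon.DualUnipotentThreeHalves`,
  stmt-ValiantsHypothesis-24318; parent crux `GrenetZeon.TwoDimCoefficients`, stmt-ValiantsHypothesis-8062)

NEGATION-LENS PORTRAIT, third coordinate.  The two registered portrait lines (`wild_unfold`: the wild constituents of a
hypothetical `m = o(n^{3/2})` representation have INDEX MASS `Σ_l r_l·d_l ≫ m`; `wild_mass`: they carry `(1 − o(1))·n²`
PARAMETERS) are each satisfied by a DIFFERENT kind of constituent — fat index-3 blocks of Mathes–Omladič–Radjavi type pay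
the parameter bill, one thin block of index `≈ n` pays the index bill — so `U2 ∨ F2` has no lever.  This line couples the
two bills PER CONSTITUENT:

* **T1 `MixedFlat` (per-specific) — PROVED in rev 2 (`mixedFlat_holds`: full unfolding by the landed `Unfold.unfN/unfM`,
  `trace_unfN_pow_mul_unfM`, graded by a MIXED level function, then the landed F1 `finrank_le_of_diagStill`).**  In a block form of ANY affine
  trace-of-power representation `per_n = tr(N^d M)` one may pay each level `l` EITHER by its nil-index (`r_l − 1` extra
  levels after unfolding it) OR by its parameters (the directions moving it are not counted):
  `dim K_S ≤ 2n·(g + Σ_{l∈S}(r_l − 1))`, `K_S` = directions keeping every constituent of level `∉ S` still; with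
  `codim K_S = wildRank ≤ Σ_{l∉S} δ_l` this is `n² ≤ 2n(g + Σ_{l∈S}(r_l − 1)) + Σ_{l∉S} δ_l` for EVERY `S`.
* **T2 `ThinWild` (THE CRUX; per-agnostic linear algebra = the quantitative form of the open QUESTION of
  Mathes–Omladič–Radjavi, LAA 149 (1991) §5 p. 224: "what is the maximal dimension of an irreducible linear space of
  nilpotents?").**  An IRREDUCIBLE linear space of nilpotent `d × d` matrices containing an element of nil-index `> r` has
  dimension `≤ C·d²/r`: wildness (irreducibility) and a long Jordan chain together force thinness.  Consistent with every
  family we know: MOR `{S⊗A + R⊗cI}` (`d = pk`, index `p`, `dim = k² + 1 = d²/p² + 1`), `span{S, R_{d−2}}` (index `d`,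
  dim 2), index-2 spaces (triangularisable, Sweet–MacDougall 2009), Gerstenhaber's `d(d−1)/2` (attained only by `𝔫_d`,
  reducible).
* **T3 `ThinWildBlockForm` (per-agnostic KNAPSACK, size M given T2: composition series + chunking at scale `q` +
  Gerstenhaber `finrank_le_choose_two` for the chunks + T2 for the constituents of size `≥ q`).**  Every nilpotent linear
  pencil of width `m` is conjugate to a block form with `q²·(g + Σ_{l∈S}(r_l − 1)) + wildRank_S ≤ C·q·(m + q)` for every
  scale `q ≥ 1`.
* **Composition (PROVED below, `dualUnipotentThreeHalves_of`):** normal form (`exists_nilpotent_pencil_of_dualUnipotentRepr`)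
  → T3 at `q = ⌊√n⌋` → conjugate the representation → T1 → rank–nullity → `n² ≤ 16·C·⌊√n⌋·m` → `n³ ≤ 256·C²·m²`, i.e.
  `GrenetZeon.DualUnipotentThreeHalves` BY NAME.

So the 3/2 rung is reduced to ONE per-agnostic statement about irreducible nilpotent matrix spaces (T2) plus one M-sized
per-agnostic knapsack stub (T3 from T2♭); rev 2: `dualUnipotentThreeHalves_of_blockForm : ThinWildBlockForm →
DualUnipotentThreeHalves` is sorry-free — the open content of the line is PURE LINEAR ALGEBRA.  If T2 is FALSE, its counterexample (a fat irreducible nilpotent space with a long chain) is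
exactly the local building block a width-`o(n^{3/2})` representation of `per_n` must be made of (negation lens: the typed
obstruction becomes a construction target).  HONEST FRAMING: nothing here is per-specific beyond T1 (flats of `per_n`,
LEMMA_k); `stub_dualUnipotent`, the 3/2 rung, crux 8062 and `VP ≠ VNP` are NOT moved by this file.
-/

set_option linter.dupNamespace false
set_option autoImplicit false

noncomputable section

namespace Summit.ValiantsHypothesis.ValiantsHypothesis.Cruxes.DualUnipotentThreeHalves.ThinWild

open MvPolynomial Matrix
open scoped BigOperators
open Literature.Computability.AlgebraicComplexity
open Summit.ValiantsHypothesis.ValiantsHypothesis.Cruxes.TwoDimCoefficients.DimTwoCases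
  (AffMat IsAffine DualUnipotentRepr exists_nilpotent_pencil_of_dualUnipotentRepr isAffine_mul_map_C diagBlock
    finrank_le_of_diagStill)
open Summit.ValiantsHypothesis.ValiantsHypothesis.Theses.GrenetZeon (DualUnipotentThreeHalves)

/-! ## Block data (the `wild_portrait` definitions verbatim, same names, so the lines compose by `Iff.rfl`) -/

/-- `N` is block-upper-triangular for the level function `lev`. -/
def IsBlockUpper {n m : ℕ} (N : AffMat n m) (lev : Fin m → ℕ) : Prop :=
  ∀ i j : Fin m, lev j < lev i → N i j = 0

-- `diagBlock N lev l` (the `l`-th diagonal constituent, zero-padded) is the landed `DimTwoCases.diagBlock`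
-- (`…DualUnipotentUnfoldCore`): `fun i j => if lev i = l ∧ lev j = l then N i j else 0`.

/-- The linear coefficient of entry `(i, j)` of the pencil in direction `v`. -/
def linCoeff {n m : ℕ} (N : AffMat n m) (v : Fin n × Fin n → ℂ) (i j : Fin m) : ℂ :=
  ∑ c, v c * coeff (Finsupp.single c 1) (N i j)

theorem linCoeff_add {n m : ℕ} (N : AffMat n m) (v w : Fin n × Fin n → ℂ) (i j : Fin m) :
    linCoeff N (v + w) i j = linCoeff N v i j + linCoeff N w i j := by
  simp only [linCoeff, Pi.add_apply, add_mul, Finset.sum_add_distrib]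

theorem linCoeff_smul {n m : ℕ} (N : AffMat n m) (a : ℂ) (v : Fin n × Fin n → ℂ) (i j : Fin m) :
    linCoeff N (a • v) i j = a * linCoeff N v i j := by
  simp only [linCoeff, Pi.smul_apply, smul_eq_mul, mul_assoc, Finset.mul_sum]

/-- The WILD-PARAMETER MAP off `S`: a direction `v` is sent to the linear coefficients, along `v`, of the diagonal
constituents whose level is NOT in `S` (entries `(i, j)` with `lev i = lev j ∉ S`), zero elsewhere. -/
def wildMap {n m : ℕ} (N : AffMat n m) (lev : Fin m → ℕ) (S : Finset ℕ) :
    (Fin n × Fin n → ℂ) →ₗ[ℂ] (Fin m × Fin m → ℂ) where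
  toFun v := fun ij => if lev ij.1 = lev ij.2 ∧ lev ij.1 ∉ S then linCoeff N v ij.1 ij.2 else 0
  map_add' v w := by
    funext ij
    simp only [Pi.add_apply, linCoeff_add]
    split_ifs <;> simp
  map_smul' a v := by
    funext ij
    simp only [Pi.smul_apply, smul_eq_mul, RingHom.id_apply, linCoeff_smul]
    split_ifs <;> simp

/-- `K_S`: the directions along which every diagonal constituent of level `∉ S` is STILL. (`S = ∅`: `DiagStill` of line
`wild_mass`; `S ⊇` all levels: everything.) -/
def stillSpace {n m : ℕ} (N : AffMat n m) (lev : Fin m → ℕ) (S : Finset ℕ) : Submodule ℂ (Fin n × Fin n → ℂ) :=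
  LinearMap.ker (wildMap N lev S)

/-- WILD RANK off `S` (`= codim K_S`): the number of independent linear parameters carried jointly by the diagonal
constituents of level `∉ S`. -/
def wildRank {n m : ℕ} (N : AffMat n m) (lev : Fin m → ℕ) (S : Finset ℕ) : ℕ :=
  Module.finrank ℂ (LinearMap.range (wildMap N lev S))

/-- INDEXED LEVEL COUNT of block data `(g, S, r)`: `g` levels, each level `l ∈ S` unfolded into `r l` levels. -/
def levelCharge (g : ℕ) (S : Finset ℕ) (r : ℕ → ℕ) : ℕ := g + ∑ l ∈ S, (r l - 1)

/-! ## The three statements -/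

/-- **T1 — MIXED FLATNESS (per-specific; provable, size M).**  If `per_n = tr(N^d·M)` with `N, M` affine, `N` block-upper
for `lev` with `< g` levels and constituent index data `r` (`(diagBlock N lev l)^{r l} = 0`), then for EVERY set `S` of
levels `dim K_S ≤ 2·(g + Σ_{l∈S}(r_l − 1))·n`.  Route: unfold every level into `r_l` copies (U1, `wild_unfold`,
`unfN/unfM`, same trace polynomial), give the copies `(l, c)` of a level `l ∈ S` separate levels and the copies of a level
`l ∉ S` ONE common level (the unfolded pencil is block-upper for this mixed level function, with zero constituents on `S`
and constituents `D_l ⊗ J_{r_l}` off `S`, still along `K_S`), then F1 `finrank_le_of_diagStill`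
(`…DualUnipotentLevelFlat`) with `g + Σ_{l∈S}(r_l − 1)` levels.  `S = ∅` is F1 itself; `S =` all levels gives
`n² ≤ 2n·Σ_l r_l`. [folklore route; statement of this development] -/
def MixedFlat : Prop :=
  ∀ (n m d g : ℕ) (N M : AffMat n m) (lev : Fin m → ℕ) (S : Finset ℕ) (r : ℕ → ℕ),
    IsAffine N → IsAffine M → IsBlockUpper N lev → (∀ u : Fin m, lev u < g) →
    (∀ l : ℕ, diagBlock N lev l ^ r l = 0) → perPoly (Fin n) ℂ = (N ^ d * M).trace →
      Module.finrank ℂ (stillSpace N lev S) ≤ 2 * levelCharge g S r * n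

/-- **T2 — THIN WILD (THE CRUX of the line; per-agnostic).**  There is an absolute `C` such that every IRREDUCIBLE linear
space `L` of nilpotent `d × d` complex matrices containing an element `N` with `N^r ≠ 0` satisfies `dim L · r ≤ C·d²`.
(Mathes–Omladič–Radjavi 1991 §5 ask for `max dim L` and give `(d/3)² + 1` at index 3 and the 2-dimensional irreducible
`span{S, R_{d−2}}` at index `d`; no bound between `2` and Gerstenhaber's `d(d−1)/2 − 1` is in print.)  Why it might fail: an
irreducible family with `dim · index ≫ d²` (e.g. index `≈ √d`, dim `≈ d²/4`) — none is known; cheapest falsifier = the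
classification tables of nilpotent spaces in `M_4, M_5` (Gutierrez Fernandez–Garcia 2026) and the `S ⊗ 𝒜 + R ⊗ ℬ` templates. -/
def ThinWild : Prop :=
  ∃ C : ℕ, ∀ (d r : ℕ) (L : Submodule ℂ (Matrix (Fin d) (Fin d) ℂ)),
    (∀ N ∈ L, IsNilpotent N) →
    (∀ W : Submodule ℂ (Fin d → ℂ), (∀ N ∈ L, ∀ w ∈ W, N.mulVec w ∈ W) → W = ⊥ ∨ W = ⊤) →
    (∃ N ∈ L, N ^ r ≠ 0) → Module.finrank ℂ L * r ≤ C * d ^ 2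

/-- **T2♭ — THIN WILD, FAT REGIME (the EXACT per-agnostic load of the line; implied by T2).**  The same inequality
`dim L · r ≤ C·d²`, asked only of FAT irreducible spaces, `(dim L)³ ≥ d⁴`: «a fat irreducible space of nilpotents has only
short Jordan chains, index `≤ C·d²/dim L ≤ C·d^{2/3}`».  Thin-but-long hypothetical counterexamples to T2
(`dim ≈ d^{1.2}`, index `≈ d^{0.9}`) are irrelevant to the 3/2 rung. -/
def ThinWildFat : Prop :=
  ∃ C : ℕ, ∀ (d r : ℕ) (L : Submodule ℂ (Matrix (Fin d) (Fin d) ℂ)),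
    (∀ N ∈ L, IsNilpotent N) →
    (∀ W : Submodule ℂ (Fin d → ℂ), (∀ N ∈ L, ∀ w ∈ W, N.mulVec w ∈ W) → W = ⊥ ∨ W = ⊤) →
    (∃ N ∈ L, N ^ r ≠ 0) → d ^ 4 ≤ Module.finrank ℂ L ^ 3 → Module.finrank ℂ L * r ≤ C * d ^ 2

/-- T2 ⇒ T2♭ (drop the fatness hypothesis). -/
theorem thinWildFat_of_thinWild (h : ThinWild) : ThinWildFat := by
  obtain ⟨C, hC⟩ := h
  exact ⟨C, fun d r L hnil hirr hidx _ => hC d r L hnil hirr hidx⟩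

/-- **T3 — THIN-WILD BLOCK FORM (per-agnostic; the knapsack, size M GIVEN T2).**  For every scale `q ≥ 1`, every nilpotent
LINEAR pencil `N` of width `m` (entries linear forms, `N^m = 0`) is conjugate (`P·N·Q`, `P·Q = 1`) to a block-upper form with
`< g` levels, index data `r` and a set `S` of levels such that `q²·(g + Σ_{l∈S}(r_l − 1)) + wildRank_S ≤ C·q·(m + q)`.
Route from T2: composition series of the space `{N(x)}` (irreducible constituents; sizes `d_l`, indices `r_l`, dims
`δ_l ≤ C·d_l²/r_l` by T2); constituents of size `≥ q` are their own levels and go to `S` iff `q²·r_l ≤ δ_l` (charge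
`≤ min(q² r_l, δ_l) ≤ √C·q·d_l`); runs of smaller constituents are chunked into levels of size `< 2q` kept off `S` (charge
`≤ q² + dim ≤ 3q²` by `Literature.…GerstenhaberNilpotentSubspace.finrank_le_choose_two`, at most `2m/q + 1` chunks);
`wildRank ≤ Σ` of the charges (rank is subadditive).  Only the regime `m ≤ q³` is requested (for `m > q³ = ⌊√n⌋³` the
rung is free), so constituents have size `d ≤ q³` and a constituent with `δ_l³ < d_l⁴` costs `δ_l ≤ q·d_l` WITHOUT T2:
the weaker `ThinWildFat` (T2♭) already gives T3 (`stub_blockForm_of_thinWildFat`). [statement of this development] -/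
def ThinWildBlockForm : Prop :=
  ∃ C : ℕ, ∀ (n m q : ℕ) (N : AffMat n m), 1 ≤ q → m ≤ q ^ 3 → (∀ i j, (N i j).IsHomogeneous 1) → N ^ m = 0 →
    ∃ (P Q : Matrix (Fin m) (Fin m) ℂ) (lev : Fin m → ℕ) (g : ℕ) (S : Finset ℕ) (r : ℕ → ℕ),
      P * Q = 1 ∧ IsBlockUpper (P.map MvPolynomial.C * N * Q.map MvPolynomial.C) lev ∧ (∀ u : Fin m, lev u < g) ∧
      (∀ l : ℕ, diagBlock (P.map MvPolynomial.C * N * Q.map MvPolynomial.C) lev l ^ r l = 0) ∧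
      q ^ 2 * levelCharge g S r + wildRank (P.map MvPolynomial.C * N * Q.map MvPolynomial.C) lev S ≤ C * q * (m + q)

/-! ## Registered stubs -/

open Summit.ValiantsHypothesis.ValiantsHypothesis.Cruxes.TwoDimCoefficients.DimTwoCases.Unfold in
/-- **T1 PROVED (rev 2).**  Mixed flatness: unfold EVERY level into its `r l` copies (landed `Unfold.unfN/unfM`,
`trace_unfN_pow_mul_unfM`), but grade the unfolded pencil by the MIXED level function
`lv (u, c) = base (lev u) + [lev u ∈ S]·c`, `base l = Σ_{l' < l} ([l' ∈ S]·r l' + [l' ∉ S]·1)`: levels in `S` are spread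
over `r l` levels (their diagonal blocks become `0`), levels off `S` keep ONE level (diagonal block = the copies
`c → c+1` of `D_l`, still exactly along `K_S`).  Then F1 `finrank_le_of_diagStill` on the reindexed pencil gives
`dim K_S ≤ 2·(base g)·n ≤ 2·levelCharge·n`. -/
theorem mixedFlat_holds : MixedFlat := by
  classical
  intro n m d g N M lev S r hN hM hup hg hnil hper
  -- mixed widths / bases / level function on the unfolded states
  let wd : ℕ → ℕ := fun l => if l ∈ S then r l else 1
  let base : ℕ → ℕ := fun l => ∑ l' ∈ Finset.range l, wd l'
  let lv : St lev r → ℕ := fun s => base (lev s.1) + if lev s.1 ∈ S then (s.2 : ℕ) else 0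
  have hbase_mono : ∀ a b, a ≤ b → base a ≤ base b := fun a b hab =>
    Finset.sum_le_sum_of_subset (Finset.range_mono hab)
  have hbase_succ : ∀ a, base (a + 1) = base a + wd a := fun a => Finset.sum_range_succ _ _
  have hlv_lt : ∀ s : St lev r, lv s < base (lev s.1 + 1) := by
    rintro ⟨u, c⟩
    rw [hbase_succ]
    by_cases h : lev u ∈ S
    · have hc : (c : ℕ) < r (lev u) := c.isLt
      simp only [lv, wd, h, if_true]
      omega
    · simp only [lv, wd, h, if_false]
      omega
  have hlv_le : ∀ s : St lev r, base (lev s.1) ≤ lv s := fun s => Nat.le_add_right _ _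
  have hlv_g : ∀ s : St lev r, lv s < base g := fun s =>
    lt_of_lt_of_le (hlv_lt s) (hbase_mono _ _ (hg s.1))
  -- the unfolded pencil is block-upper for `lv`
  have hup' : ∀ s t : St lev r, lv t < lv s → unfN lev r N s t = 0 := by
    intro s t hts
    simp only [unfN]
    rw [if_neg]
    rintro (⟨hl, hc⟩ | ⟨hl, hc⟩)
    · -- same level: `lv t ≥ lv s`
      apply absurd hts
      apply not_lt.mpr
      simp only [lv, hl]
      split_ifs <;> omega
    · apply absurd hts
      apply not_lt.mpr
      calc lv s ≤ base (lev s.1 + 1) := (hlv_lt s).le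
        _ ≤ base (lev t.1) := hbase_mono _ _ hl
        _ ≤ lv t := hlv_le t
  -- `K_S` is diagonal-still for the unfolded pencil graded by `lv`
  have hK' : ∀ v ∈ stillSpace N lev S, ∀ s t : St lev r, lv s = lv t →
      ∑ c, v c * coeff (Finsupp.single c 1) (unfN lev r N s t) = 0 := by
    intro v hv s t hst
    simp only [unfN]
    split_ifs with hcond
    · rcases hcond with ⟨hl, hc⟩ | ⟨hl, hc⟩
      · -- same level `l`, `t.2 = s.2 + 1`: equal `lv` forces `l ∉ S`, where `v` is still
        have hnS : lev s.1 ∉ S := by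
          intro hS
          have ht : lev t.1 ∈ S := hl ▸ hS
          have h1 : lv s = base (lev s.1) + (s.2 : ℕ) := by simp only [lv, if_pos hS]
          have h2 : lv t = base (lev t.1) + (t.2 : ℕ) := by simp only [lv, if_pos ht]
          have hb : base (lev s.1) = base (lev t.1) := by rw [hl]
          have hc' : (t.2 : ℕ) = (s.2 : ℕ) + 1 := hc
          omega
        have hker : wildMap N lev S v (s.1, t.1) = 0 := by
          have := hv
          rw [stillSpace, LinearMap.mem_ker] at this
          rw [this]; rfl
        simpa [wildMap, hl, hl ▸ hnS, linCoeff] using hker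
      · exfalso
        have : lv s < lv t :=
          calc lv s < base (lev s.1 + 1) := hlv_lt s
            _ ≤ base (lev t.1) := hbase_mono _ _ hl
            _ ≤ lv t := hlv_le t
        omega
    · simp
  -- reindex the states by `Fin I`
  let e : Fin (Fintype.card (St lev r)) ≃ St lev r := (Fintype.equivFin (St lev r)).symm
  let N' : AffMat n (Fintype.card (St lev r)) := (unfN lev r N).submatrix e e
  let M' : AffMat n (Fintype.card (St lev r)) := (unfM lev r M).submatrix e e
  have hN' : IsAffine N' := by
    intro i j
    simp only [N', Matrix.submatrix_apply, unfN]
    split_ifs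
    · exact hN _ _
    · rw [totalDegree_zero]; exact Nat.zero_le _
  have hM' : IsAffine M' := by
    intro i j
    simp only [M', Matrix.submatrix_apply, unfM]
    split_ifs
    · exact hM _ _
    · rw [totalDegree_zero]; exact Nat.zero_le _
  have htr : ∀ (A : Matrix (St lev r) (St lev r) (MvPolynomial (Fin n × Fin n) ℂ)),
      (A.submatrix e e).trace = A.trace := by
    intro A
    simp only [Matrix.trace, Matrix.diag_apply, Matrix.submatrix_apply]
    exact e.sum_comp (fun s => A s s)
  have hpow : ∀ k : ℕ, N' ^ k = (unfN lev r N ^ k).submatrix e e := by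
    intro k
    induction k with
    | zero => rw [pow_zero, pow_zero, Matrix.submatrix_one_equiv]
    | succ k ih => rw [pow_succ, pow_succ, ih, Matrix.submatrix_mul_equiv]
  have hre : N' ^ d * M' = (unfN lev r N ^ d * unfM lev r M).submatrix e e := by
    rw [hpow d, Matrix.submatrix_mul_equiv]
  have hper' : perPoly (Fin n) ℂ = (N' ^ d * M').trace := by
    rw [hre, htr, trace_unfN_pow_mul_unfM N M hup hnil d]
    exact hper
  have hfl := finrank_le_of_diagStill (d := d) (g := base g) N' M' (lv ∘ e) (stillSpace N lev S) hN' hM'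
    (fun i j hij => hup' (e i) (e j) hij) (fun i => hlv_g (e i)) hper'
    (fun v hv i j hij => hK' v hv (e i) (e j) hij)
  -- `base g ≤ levelCharge g S r`
  have hwd : ∀ l, wd l ≤ 1 + (if l ∈ S then r l - 1 else 0) := by
    intro l
    by_cases h : l ∈ S
    · simp only [wd, h, if_true]; omega
    · simp only [wd, h, if_false]; omega
  have hbase_g : base g ≤ levelCharge g S r := by
    calc base g ≤ ∑ l ∈ Finset.range g, (1 + (if l ∈ S then r l - 1 else 0)) := Finset.sum_le_sum fun l _ => hwd l
      _ = g + ∑ l ∈ Finset.range g ∩ S, (r l - 1) := by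
          rw [Finset.sum_add_distrib, Finset.sum_const, Finset.card_range, smul_eq_mul, mul_one,
            Finset.sum_ite_mem]
      _ ≤ g + ∑ l ∈ S, (r l - 1) :=
          Nat.add_le_add_left (Finset.sum_le_sum_of_subset Finset.inter_subset_right) _
      _ = levelCharge g S r := rfl
  calc Module.finrank ℂ (stillSpace N lev S) ≤ 2 * base g * n := hfl
    _ ≤ 2 * levelCharge g S r * n := by gcongr

theorem stub_thinWild : ThinWild := by
  sorry

/-- T3 from T2♭ (per-agnostic, M): composition series + chunking at scale `q` + Gerstenhaber + rank subadditivity (see the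
docstring of `ThinWildBlockForm`). -/
theorem stub_blockForm_of_thinWildFat : ThinWildFat → ThinWildBlockForm := by
  sorry

/-- T3 from T2 (T2 ⇒ T2♭ ⇒ T3). -/
theorem blockForm_of_thinWild (h : ThinWild) : ThinWildBlockForm :=
  stub_blockForm_of_thinWildFat (thinWildFat_of_thinWild h)

/-! ## Conjugating a representation (generic matrix algebra) -/

section Conj

variable {n m : ℕ}

/-- Entries of `T · A` (`T` constant) are affine when `A` is. [folklore] -/
theorem isAffine_map_C_mul (T : Matrix (Fin m) (Fin m) ℂ) (A : AffMat n m) (hA : IsAffine A) :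
    IsAffine (T.map C * A) := by
  intro i j
  rw [Matrix.mul_apply]
  refine (totalDegree_finsetSum _ _).trans (Finset.sup_le fun k _ => ?_)
  rw [Matrix.map_apply]
  refine (totalDegree_mul _ _).trans ?_
  rw [totalDegree_C, zero_add]
  exact hA k j

theorem isAffine_conj (P Q : Matrix (Fin m) (Fin m) ℂ) (A : AffMat n m) (hA : IsAffine A) :
    IsAffine (P.map C * A * Q.map C) :=
  isAffine_mul_map_C _ (isAffine_map_C_mul P A hA) Q

theorem map_C_mul_map_C_eq_one (P Q : Matrix (Fin m) (Fin m) ℂ) (h : P * Q = 1) :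
    (P.map C * Q.map C : AffMat n m) = 1 := by
  rw [← Matrix.map_mul, h, Matrix.map_one C C_0 C_1]

theorem conj_pow (P Q : Matrix (Fin m) (Fin m) ℂ) (N : AffMat n m) (hPQ : P * Q = 1) (hQP : Q * P = 1) (d : ℕ) :
    (P.map C * N * Q.map C) ^ d = P.map C * N ^ d * Q.map C := by
  induction d with
  | zero => rw [pow_zero, pow_zero, Matrix.mul_one, map_C_mul_map_C_eq_one P Q hPQ]
  | succ d ih =>
      rw [pow_succ, ih, pow_succ]
      have h1 : (Q.map C : AffMat n m) * P.map C = 1 := map_C_mul_map_C_eq_one Q P hQP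
      calc P.map C * N ^ d * Q.map C * (P.map C * N * Q.map C)
          = P.map C * N ^ d * (Q.map C * P.map C) * N * Q.map C := by
            simp only [Matrix.mul_assoc]
        _ = P.map C * (N ^ d * N) * Q.map C := by rw [h1, Matrix.mul_one]; simp only [Matrix.mul_assoc]

/-- Conjugation does not change the trace polynomial `tr(N^d·M)`. [folklore] -/
theorem trace_conj_pow_mul (P Q : Matrix (Fin m) (Fin m) ℂ) (N M : AffMat n m) (hPQ : P * Q = 1)
    (hQP : Q * P = 1) (d : ℕ) :
    ((P.map C * N * Q.map C) ^ d * (P.map C * M * Q.map C)).trace = (N ^ d * M).trace := by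
  rw [conj_pow P Q N hPQ hQP d]
  have h1 : (Q.map C : AffMat n m) * P.map C = 1 := map_C_mul_map_C_eq_one Q P hQP
  calc (P.map C * N ^ d * Q.map C * (P.map C * M * Q.map C)).trace
      = (P.map C * N ^ d * (Q.map C * P.map C) * M * Q.map C).trace := by simp only [Matrix.mul_assoc]
    _ = ((P.map C * (N ^ d * M)) * Q.map C).trace := by rw [h1, Matrix.mul_one]; simp only [Matrix.mul_assoc]
    _ = (Q.map C * (P.map C * (N ^ d * M))).trace := Matrix.trace_mul_comm _ _
    _ = (N ^ d * M).trace := by rw [← Matrix.mul_assoc, h1, Matrix.one_mul]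

end Conj

/-- The arithmetic of the composition: `n² = W + dim K_S ≤ W + 2Ln ≤ 8(q²L + W) ≤ 8Cq(m+q)`, `n ≥ 16C + 4`
⇒ `n² ≤ 16Cqm` ⇒ `n³ ≤ 256C²m²`. -/
theorem cube_le_of_charges (n m q C L W fk : ℕ) (hs1 : q ^ 2 ≤ n) (hs2 : n < (q + 1) ^ 2)
    (hn : 16 * C + 4 ≤ n) (hineq : q ^ 2 * L + W ≤ C * q * (m + q)) (hflat : fk ≤ 2 * L * n)
    (hsum : n * n = W + fk) : n ^ 3 ≤ 256 * C ^ 2 * m ^ 2 := by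
  have hn4 : n ≤ 4 * q ^ 2 := by nlinarith [hs2]
  have h1 : n * n ≤ W + 2 * L * n := by rw [hsum]; omega
  have h2 : n * n ≤ 8 * (q ^ 2 * L + W) := by
    have : 2 * L * n ≤ 2 * L * (4 * q ^ 2) := Nat.mul_le_mul_left _ hn4
    nlinarith [h1, this]
  have h3 : n * n ≤ 8 * C * q * m + 8 * C * n := by
    have : 8 * (q ^ 2 * L + W) ≤ 8 * (C * q * (m + q)) := Nat.mul_le_mul_left _ hineq
    have h' : C * q * q ≤ C * n := by rw [mul_assoc]; exact Nat.mul_le_mul_left _ (by rw [← pow_two]; exact hs1)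
    nlinarith [h2, this, h']
  have h4 : 16 * C * n ≤ n * n := Nat.mul_le_mul_right _ (by omega)
  have h5 : n * n ≤ 16 * C * q * m := by linarith [h3, h4]
  have h6 : (n * n) * (n * n) ≤ (16 * C * q * m) * (16 * C * q * m) := Nat.mul_le_mul h5 h5
  have hqq : q * q ≤ n := by rw [← pow_two]; exact hs1
  have h7 : (n * n) * (n * n) ≤ n * (256 * C ^ 2 * m ^ 2) := by
    calc (n * n) * (n * n) ≤ (16 * C * q * m) * (16 * C * q * m) := h6
      _ = (q * q) * (256 * C ^ 2 * m ^ 2) := by ring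
      _ ≤ n * (256 * C ^ 2 * m ^ 2) := Nat.mul_le_mul_right _ hqq
  have hn0 : 0 < n := by omega
  have h8 : n * (n ^ 3) ≤ n * (256 * C ^ 2 * m ^ 2) := by
    calc n * n ^ 3 = (n * n) * (n * n) := by ring
      _ ≤ n * (256 * C ^ 2 * m ^ 2) := h7
  exact Nat.le_of_mul_le_mul_left h8 hn0

/-! ## The composition (kernel-checked): `MixedFlat → ThinWildBlockForm → DualUnipotentThreeHalves` -/

/-- Rank–nullity for the wild-parameter map: `n² = wildRank_S + dim K_S`. -/
theorem sq_eq_wildRank_add_finrank_stillSpace {n m : ℕ} (N : AffMat n m) (lev : Fin m → ℕ) (S : Finset ℕ) :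
    n * n = wildRank N lev S + Module.finrank ℂ (stillSpace N lev S) := by
  have hrn := LinearMap.finrank_range_add_finrank_ker (wildMap N lev S)
  have hdim : Module.finrank ℂ (Fin n × Fin n → ℂ) = n * n := by
    simp [Module.finrank_fintype_fun_eq_card]
  rw [← hdim, ← hrn]
  rfl

/-- **The deciding chain of the line** (target decl BY NAME; its hypothesis is definitionally `DualUnipotentRepr n m`). -/
theorem dualUnipotentThreeHalves_of (hT1 : MixedFlat) (hT3 : ThinWildBlockForm) : DualUnipotentThreeHalves := by
  obtain ⟨C₀, hC⟩ := hT3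
  refine ⟨256 * C₀ ^ 2 + 64, 16 * C₀ + 4, ?_⟩
  intro n hn m hrep
  have hrep' : DualUnipotentRepr n m := hrep
  have hn1 : 1 ≤ n := by omega
  obtain ⟨N, M, hN, hM, hnil, hper⟩ := exists_nilpotent_pencil_of_dualUnipotentRepr hn1 hrep'
  set q := Nat.sqrt n with hq
  have hs1 : q ^ 2 ≤ n := Nat.sqrt_le' n
  have hs2 : n < (q + 1) ^ 2 := Nat.lt_succ_sqrt' n
  have hq1 : 1 ≤ q := Nat.succ_le_of_lt (Nat.sqrt_pos.2 (by omega))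
  by_cases hm : m ≤ q ^ 3
  · obtain ⟨P, Q, lev, g, S, r, hPQ, hup, hg, hnilB, hineq⟩ := hC n m q N hq1 hm hN hnil
    have hQP : Q * P = 1 := mul_eq_one_comm.mp hPQ
    have haffN' : IsAffine (P.map C * N * Q.map C) := isAffine_conj P Q N (fun i j => (hN i j).totalDegree_le)
    have haffM' : IsAffine (P.map C * M * Q.map C) := isAffine_conj P Q M (fun i j => (hM i j).totalDegree_le)
    have hper' : perPoly (Fin n) ℂ = ((P.map C * N * Q.map C) ^ (n - 1) * (P.map C * M * Q.map C)).trace := by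
      rw [hper]; exact (trace_conj_pow_mul P Q N M hPQ hQP (n - 1)).symm
    have hflat := hT1 n m (n - 1) g _ _ lev S r haffN' haffM' hup hg hnilB hper'
    have hsum := sq_eq_wildRank_add_finrank_stillSpace (P.map C * N * Q.map C) lev S
    have hmain := cube_le_of_charges n m q C₀ (levelCharge g S r) (wildRank (P.map C * N * Q.map C) lev S)
      (Module.finrank ℂ (stillSpace (P.map C * N * Q.map C) lev S)) hs1 hs2 hn hineq hflat hsum
    nlinarith [hmain]
  · -- `m > ⌊√n⌋³`: the rung is free, `n³ ≤ 64·⌊√n⌋⁶ ≤ 64·m²`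
    have hm' : q ^ 3 ≤ m := by omega
    have hn4 : n ≤ 4 * q ^ 2 := by nlinarith [hs2]
    have h1 : n ^ 3 ≤ 64 * (q ^ 3) ^ 2 := by
      calc n ^ 3 ≤ (4 * q ^ 2) ^ 3 := Nat.pow_le_pow_left hn4 3
        _ = 64 * (q ^ 3) ^ 2 := by ring
    have h2 : (q ^ 3) ^ 2 ≤ m ^ 2 := Nat.pow_le_pow_left hm' 2
    nlinarith [h1, h2]

/-- The target through the registered stubs (T1; T3 ← T2♭ ← T2). -/
theorem dualUnipotentThreeHalves_via_stubs : DualUnipotentThreeHalves :=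
  dualUnipotentThreeHalves_of mixedFlat_holds (blockForm_of_thinWild stub_thinWild)

/-- **Rev 2: the per-specific half is closed.**  The 3/2 rung follows from the per-agnostic block-form statement T3 alone
(sorry-free: T1 is `mixedFlat_holds`). -/
theorem dualUnipotentThreeHalves_of_blockForm (hT3 : ThinWildBlockForm) : DualUnipotentThreeHalves :=
  dualUnipotentThreeHalves_of mixedFlat_holds hT3

/-! ## Sanity -/

/-- `S = ∅`: no level is unfolded (`levelCharge = g`, T1 = F1 of `wild_mass`). -/
theorem levelCharge_empty (g : ℕ) (r : ℕ → ℕ) : levelCharge g ∅ r = g := by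
  simp [levelCharge]

/-- `S = ∅`: `K_∅` is the `DiagStill` space — a direction is in `stillSpace N lev ∅` iff it keeps EVERY diagonal
constituent still. -/
theorem mem_stillSpace_empty_iff {n m : ℕ} (N : AffMat n m) (lev : Fin m → ℕ) (v : Fin n × Fin n → ℂ) :
    v ∈ stillSpace N lev ∅ ↔ ∀ i j : Fin m, lev i = lev j → linCoeff N v i j = 0 := by
  simp only [stillSpace, LinearMap.mem_ker, wildMap, LinearMap.coe_mk, AddHom.coe_mk, Finset.notMem_empty,
    not_false_eq_true, and_true]
  constructor
  · intro h i j hij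
    have := congr_fun h (i, j)
    simpa [hij] using this
  · intro h
    funext ij
    simp only [Pi.zero_apply]
    split_ifs with hij
    · exact h ij.1 ij.2 hij
    · rfl

end Summit.ValiantsHypothesis.ValiantsHypothesis.Cruxes.DualUnipotentThreeHalves.ThinWild

end
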